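import Summits.QuantumFields.YangMills.Theorems.BalabanLadderIRcofEquipartitionSeamSpectralDictKernelCalc
import Literature.Analysis.OperatorTheory.HermitianKernelSandwichedTrace
import HarnessLib

/-!
# Crux `IRcof` (stmt-QuantumFields-26930) · line `equipartition_seam` (row 47) · stub D `KernelCurrency.SpectralDictV` — SPECTRAL DICTIONARY,
# PART 4∕5 — §7 positive type ⇒ `Re ⟪φ, 𝔸φ⟫ ≥ 0`; the Z-clause and the W-clause of `SpectralDictOn` in cast form (the W-clause via the SANDWICHED trace formula of `Literature/Analysis/OperatorTheory/HermitianKernelSandwichedTrace`, imported BY NAME — condition L2)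

SOURCE OF RECORD: `Cruxes/IRcof/Lines/equipartition_seam_SpectralDict.lean` (crux write 2e444f4e44a5, 1436 l.; author ideator ym-ir-idea-22 g7; critic ym-ir-crit-3 g5 TYPEREAD CLEAN + JUNK ∕ COSTUME ∕ SHRED PASS, bus l.≈1712, landing conditions L1–L4) — split VERBATIM along its §§ into ≤ 400-line Theorems files by LEAD prover ym-ir-line-ab-p1 g8 (LAND-ASK of idea-22 g7). §0 of the source (a verbatim copy of `Literature/Analysis/OperatorTheory/HermitianKernelSandwichedTrace.lean`) is NOT landed (condition L2): the part that needs it imports the Literature module by name.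

HONEST FRAMING.  Abstract operator theory on `L²(X, μ; ℂ)` (Koopman unitaries, joint eigenbasis, trace formulas, kernel calculus); nothing located on the lattice is proved by this file (stubs S1, S3ʷ, T, N, S5ᵛ of row 47 open; D is re-located onto the lattice stub L `SliceRealisationV` in the last part); row 47 class PWP, mechanism 0, width 0; `IRcof` ∕ `IR` 0∕1; the Yang–Mills mass gap (Clay) is NOT proved by anything in this tree; R4 closes only the conditional finite-𝕋⁴ rung `BalabanLadder.UV`.
-/

noncomputable section

open MeasureTheory Filter Function Topology
open scoped InnerProductSpace ComplexConjugate ENNReal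
open Literature.Analysis.OperatorTheory

namespace Summit.QuantumFields.YangMills.Cruxes.IRcof.EquipartitionSeam.SpectralDict

variable {X : Type*} [MeasurableSpace X] {μ : Measure X}

/-! ## §7  Positive type; the two dictionary clauses in cast form -/

section PositiveType

variable [IsFiniteMeasure μ] {K : X → X → ℂ} {A : Lp ℂ 2 μ →L[ℂ] Lp ℂ 2 μ}

omit [IsFiniteMeasure μ] in
/-- **Positive type passes to `L²(ℂ)`.**  If `Re ∬ conj f(x) K(x,y) f(y) ≥ 0` for every measurable `‖f‖ ≤ 1`, then
`0 ≤ Re ⟪φ, Aφ⟫` for every `φ ∈ L²(ℂ)` (rescaling; density of simple functions; continuity of `φ ↦ ⟪φ, Aφ⟫`) — the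
complex twin of the tree's `inner_kernelOp_self_nonneg`. [folklore] -/
theorem re_inner_kernelOp_self_nonneg
    (hA : ∀ φ : Lp ℂ 2 μ, (A φ : X → ℂ) =ᵐ[μ] fun x => ∫ y, K x y * φ y ∂μ)
    (hpt : ∀ f : X → ℂ, Measurable f → (∀ x, ‖f x‖ ≤ 1) →
      0 ≤ (∫ x, ∫ y, conj (f x) * K x y * f y ∂μ ∂μ).re) (φ : Lp ℂ 2 μ) :
    0 ≤ (⟪φ, A φ⟫_ℂ).re := by
  have hd := Lp.simpleFunc.denseRange (E := ℂ) (p := (2 : ℝ≥0∞)) (μ := μ) ENNReal.ofNat_ne_top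
  have hpt' : ∀ f : X → ℂ, Measurable f → ∀ B : ℝ, (∀ x, ‖f x‖ ≤ B) →
      0 ≤ (∫ x, ∫ y, conj (f x) * K x y * f y ∂μ ∂μ).re := by
    intro f hf B hB
    set B' := max B 1 with hB'
    have hB'0 : 0 < B' := lt_of_lt_of_le one_pos (le_max_right _ _)
    have h := hpt (fun x => f x / (B' : ℂ)) (hf.div_const _) fun x => by
      rw [norm_div, Complex.norm_real, Real.norm_eq_abs, abs_of_pos hB'0, div_le_one hB'0]
      exact (hB x).trans (le_max_left _ _)
    have he : (∫ x, ∫ y, conj (f x / (B' : ℂ)) * K x y * (f y / (B' : ℂ)) ∂μ ∂μ) =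
        (∫ x, ∫ y, conj (f x) * K x y * f y ∂μ ∂μ) / ((B' : ℂ) ^ 2) := by
      rw [← integral_div]
      refine integral_congr_ae (Eventually.of_forall fun x => ?_)
      dsimp only
      rw [← integral_div]
      refine integral_congr_ae (Eventually.of_forall fun y => ?_)
      dsimp only
      have hB'c : (B' : ℂ) ≠ 0 := by exact_mod_cast hB'0.ne'
      rw [map_div₀, Complex.conj_ofReal]
      field_simp
    rw [he] at h
    have hB2 : ((B' : ℂ) ^ 2) = ((B' ^ 2 : ℝ) : ℂ) := by push_cast; rfl
    rw [hB2, Complex.div_ofReal_re] at h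
    have h' := (le_div_iff₀ (by positivity : (0 : ℝ) < B' ^ 2)).mp h
    simpa using h'
  refine hd.induction_on (p := fun φ => 0 ≤ (⟪φ, A φ⟫_ℂ).re) φ
    (isClosed_le continuous_const (Complex.continuous_re.comp (continuous_id.inner A.continuous))) fun φs => ?_
  set f := Lp.simpleFunc.toSimpleFunc φs with hf_def
  have hf : (f : X → ℂ) =ᵐ[μ] ((φs : Lp ℂ 2 μ) : X → ℂ) := Lp.simpleFunc.toSimpleFunc_eq_toFun φs
  obtain ⟨B, hB⟩ := f.exists_forall_norm_le
  have heq : ⟪(φs : Lp ℂ 2 μ), A (φs : Lp ℂ 2 μ)⟫_ℂ = ∫ x, ∫ y, conj (f x) * K x y * f y ∂μ ∂μ := by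
    rw [inner_eq_integral_of_ae_kernel hA]
    refine integral_congr_ae ?_
    filter_upwards [hf] with x hx
    rw [← hx, ← integral_const_mul]
    refine integral_congr_ae ?_
    filter_upwards [hf] with y hy
    rw [← hy]
    ring
  show 0 ≤ (⟪(φs : Lp ℂ 2 μ), A (φs : Lp ℂ 2 μ)⟫_ℂ).re
  rw [heq]
  exact hpt' f f.measurable B hB

end PositiveType

section Clauses

/-- Cast of the iterated REAL transfer operator: `κ_ℂ^{j}[h_ℂ] = (κ^{j}[h])_ℂ` pointwise. -/
theorem iterate_kernel_ofReal (K : X → X → ℝ) (h : X → ℝ) (j : ℕ) (y : X) :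
    ((fun f : X → ℂ => fun u => ∫ z, ((K u z : ℝ) : ℂ) * f z ∂μ)^[j] (fun z => ((h z : ℝ) : ℂ))) y =
      ((((fun f : X → ℝ => fun u => ∫ z, K u z * f z ∂μ)^[j] h) y : ℝ) : ℂ) := by
  induction j generalizing y with
  | zero => rfl
  | succ j ih =>
    rw [Function.iterate_succ_apply', Function.iterate_succ_apply']
    simp_rw [ih]
    rw [← integral_complex_ofReal]
    push_cast
    rfl

variable [IsProbabilityMeasure μ] {Γ : Type*} {T : Γ → X → X}
  (hTm : ∀ c, MeasurePreserving (T c) μ μ) {K : X → X → ℝ} {C : ℝ} {A : Lp ℂ 2 μ →L[ℂ] Lp ℂ 2 μ}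
  {ι : Type*} [Countable ι] {b : HilbertBasis ι ℂ (Lp ℂ 2 μ)} {lam : ι → ℝ} {χ : ι → Γ → ℂ}

/-- **Z-clause in cast form**: `Σᵢ χᵢ(e) λᵢ^{M+2} = (∫ (κ^{M+1} K(·, x))(T_e x) dμ(x))_ℂ` (the twisted trace formula of §4
for the complexified real kernel, with the iterate cast back to `ℝ`). -/
theorem hasSum_chi_pow_ofReal_iterate (hK : StronglyMeasurable (uncurry K)) (hC : ∀ x y, ‖K x y‖ ≤ C)
    (hsymm : ∀ x y, K x y = K y x)
    (hA : ∀ φ : Lp ℂ 2 μ, (A φ : X → ℂ) =ᵐ[μ] fun x => ∫ y, ((K x y : ℝ) : ℂ) * φ y ∂μ)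
    (hb : ∀ i, A (b i) = (lam i : ℂ) • b i)
    (hχ : ∀ i c, lam i ≠ 0 → koop (T c) (hTm c) (b i) = χ i c • b i) (e : Γ) (M : ℕ) :
    HasSum (fun i => χ i e * (lam i : ℂ) ^ (M + 2))
      (((∫ x, ((fun f : X → ℝ => fun u => ∫ z, K u z * f z ∂μ)^[M + 1] (fun z => K z x)) (T e x) ∂μ : ℝ) : ℂ)) := by
  have hKc : StronglyMeasurable (uncurry fun x y => ((K x y : ℝ) : ℂ)) :=
    Complex.continuous_ofReal.comp_stronglyMeasurable hK
  have hCc : ∀ x y, ‖((K x y : ℝ) : ℂ)‖ ≤ C := fun x y => by rw [Complex.norm_real]; exact hC x y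
  have hherm : ∀ x y, ((K x y : ℝ) : ℂ) = conj ((K y x : ℝ) : ℂ) := fun x y => by
    rw [Complex.conj_ofReal, hsymm]
  have h := hasSum_chi_pow_integral_iterate_twisted hKc hCc hherm hA hb (hTm e) (χ := fun i => χ i e)
    (fun i hi => hχ i e hi) M
  have hv : ∀ x, ((fun f : X → ℂ => fun u => ∫ z, ((K u z : ℝ) : ℂ) * f z ∂μ)^[M + 1]
      (fun z => ((K z x : ℝ) : ℂ))) (T e x) =
      ((((fun f : X → ℝ => fun u => ∫ z, K u z * f z ∂μ)^[M + 1] (fun z => K z x)) (T e x) : ℝ) : ℂ) := fun x =>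
    iterate_kernel_ofReal K (fun z => K z x) (M + 1) (T e x)
  rw [← integral_complex_ofReal]
  simp_rw [← hv]
  exact h

/-- **W-clause in cast form.**  For a real block kernel `B_k` (operator `B` on `L²(ℂ)`), every twist `e` and every `M`:
`Σᵢ χᵢ(e) λᵢ^{M+4} ⟪bᵢ, B bᵢ⟫ = (∫ k_e(V 0, V 1) ∏_{t<M+2} K(V (t+1), V (t+2)) dμ^{⊗(M+3)}(V))_ℂ` with the real kernel
`k_e(x, y) = ∫ K(x, u) ∫ B_k(u, v) K(T_e v, y) dμ(v) dμ(u)` of `𝔸 B U_e 𝔸` (the sandwiched trace formula of §0 for the insertion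
`B U_e`, kernels composed by §6, and `U_e bᵢ = χᵢ(e) bᵢ` wherever `λᵢ ≠ 0`). -/
theorem hasSum_chi_pow_inner_block (hK : StronglyMeasurable (uncurry K)) (hC : ∀ x y, ‖K x y‖ ≤ C)
    (hsymm : ∀ x y, K x y = K y x)
    (hA : ∀ φ : Lp ℂ 2 μ, (A φ : X → ℂ) =ᵐ[μ] fun x => ∫ y, ((K x y : ℝ) : ℂ) * φ y ∂μ)
    (hb : ∀ i, A (b i) = (lam i : ℂ) • b i)
    (hχ : ∀ i c, lam i ≠ 0 → koop (T c) (hTm c) (b i) = χ i c • b i)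
    {Bk : X → X → ℝ} {CB : ℝ} {B : Lp ℂ 2 μ →L[ℂ] Lp ℂ 2 μ} (hBk : StronglyMeasurable (uncurry Bk))
    (hCB : ∀ x y, ‖Bk x y‖ ≤ CB)
    (hB : ∀ φ : Lp ℂ 2 μ, (B φ : X → ℂ) =ᵐ[μ] fun x => ∫ y, ((Bk x y : ℝ) : ℂ) * φ y ∂μ) (e : Γ) (M : ℕ) :
    HasSum (fun i => χ i e * ((lam i ^ (M + 4) : ℝ) : ℂ) * ⟪(b i : Lp ℂ 2 μ), B (b i)⟫_ℂ)
      (((∫ V : Fin (M + 3) → X, (∫ u, K (V 0) u * ∫ v, Bk u v * K (T e v) (V 1) ∂μ ∂μ) *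
          ∏ t : Fin (M + 2), K (V t.succ) (V (t.succ + 1)) ∂(Measure.pi fun _ => μ) : ℝ) : ℂ)) := by
  -- complexified kernels
  set Kc : X → X → ℂ := fun x y => ((K x y : ℝ) : ℂ) with hKcdef
  set Bc : X → X → ℂ := fun x y => ((Bk x y : ℝ) : ℂ) with hBcdef
  have hKc : StronglyMeasurable (uncurry Kc) := Complex.continuous_ofReal.comp_stronglyMeasurable hK
  have hBc : StronglyMeasurable (uncurry Bc) := Complex.continuous_ofReal.comp_stronglyMeasurable hBk
  have hCc : ∀ x y, ‖Kc x y‖ ≤ C := fun x y => by rw [hKcdef, Complex.norm_real]; exact hC x y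
  have hCBc : ∀ x y, ‖Bc x y‖ ≤ CB := fun x y => by rw [hBcdef, Complex.norm_real]; exact hCB x y
  have hherm : ∀ x y, Kc x y = conj (Kc y x) := fun x y => by rw [hKcdef, Complex.conj_ofReal, hsymm]
  -- the insertion `B U_e` and the kernel of `𝔸 (B U_e) 𝔸`
  set U := koop (T e) (hTm e) with hUdef
  have hUA : ∀ φ : Lp ℂ 2 μ, ((U.comp A) φ : X → ℂ) =ᵐ[μ] fun x => ∫ y, Kc (T e x) y * φ y ∂μ :=
    koop_comp_ae_kernel hA (hTm e)
  have hKU : StronglyMeasurable (uncurry fun x y => Kc (T e x) y) := stronglyMeasurable_twistKernel hKc (hTm e).measurable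
  have hCU : ∀ x y, ‖Kc (T e x) y‖ ≤ C := fun x y => hCc _ _
  set k₁ : X → X → ℂ := fun x y => ∫ v, Bc x v * Kc (T e v) y ∂μ with hk₁def
  have hBUA : ∀ φ : Lp ℂ 2 μ, ((B.comp (U.comp A)) φ : X → ℂ) =ᵐ[μ] fun x => ∫ y, k₁ x y * φ y ∂μ :=
    comp_ae_kernel hBc hKU hCBc hCU hB hUA
  have hk₁m : StronglyMeasurable (uncurry k₁) := stronglyMeasurable_compKernel hBc hKU
  have hk₁C : ∀ x y, ‖k₁ x y‖ ≤ CB * C * μ.real Set.univ := fun x y => norm_compKernel_le hCBc hCU x y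
  set kB : X → X → ℂ := fun x y => ∫ u, Kc x u * k₁ u y ∂μ with hkBdef
  have hABUA : ∀ φ : Lp ℂ 2 μ, ((A.comp (B.comp (U.comp A))) φ : X → ℂ) =ᵐ[μ] fun x => ∫ y, kB x y * φ y ∂μ :=
    comp_ae_kernel hKc hk₁m hCc hk₁C hA hBUA
  have hkBm : StronglyMeasurable (uncurry kB) := stronglyMeasurable_compKernel hKc hk₁m
  have hkBC : ∀ x y, ‖kB x y‖ ≤ C * (CB * C * μ.real Set.univ) * μ.real Set.univ := fun x y =>
    norm_compKernel_le hCc hk₁C x y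
  -- the sandwiched trace formula for the insertion `B U_e`
  have hS := hasSum_pow_inner_sandwich_rclike (𝕜 := ℂ) hKc hCc hherm hA hb (B := B.comp U) hkBm hkBC
    (by simpa only [ContinuousLinearMap.comp_assoc] using hABUA) M
  -- identify the value
  have hval : (∫ V : Fin (M + 3) → X, kB (V 0) (V 1) * ∏ t : Fin (M + 2), Kc (V t.succ) (V (t.succ + 1))
      ∂(Measure.pi fun _ => μ)) =
      (((∫ V : Fin (M + 3) → X, (∫ u, K (V 0) u * ∫ v, Bk u v * K (T e v) (V 1) ∂μ ∂μ) *
          ∏ t : Fin (M + 2), K (V t.succ) (V (t.succ + 1)) ∂(Measure.pi fun _ => μ) : ℝ) : ℂ)) := by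
    rw [← integral_complex_ofReal]
    refine integral_congr_ae (Eventually.of_forall fun V => ?_)
    dsimp only
    have hk : kB (V 0) (V 1) = ((∫ u, K (V 0) u * ∫ v, Bk u v * K (T e v) (V 1) ∂μ ∂μ : ℝ) : ℂ) := by
      rw [hkBdef, ← integral_complex_ofReal]
      refine integral_congr_ae (Eventually.of_forall fun u => ?_)
      dsimp only
      rw [hk₁def]
      dsimp only
      rw [Complex.ofReal_mul, ← integral_complex_ofReal]
      congr 1
      refine integral_congr_ae (Eventually.of_forall fun v => ?_)
      dsimp only
      rw [hBcdef, hKcdef]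
      push_cast
      rfl
    rw [hk]
    push_cast
    rfl
  rw [← hval]
  -- identify the terms
  refine hS.congr_fun fun i => ?_
  by_cases hi : lam i = 0
  · rw [hi]
    push_cast
    simp
  · rw [ContinuousLinearMap.comp_apply, hUdef, hχ i e hi, map_smul, inner_smul_right]
    push_cast
    simp only [RCLike.ofReal_eq_complex_ofReal]
    ring

end Clauses

end Summit.QuantumFields.YangMills.Cruxes.IRcof.EquipartitionSeam.SpectralDict

end
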